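import Mathlib
import Literature.Probability.Percolation.PercolationProofs
import Literature.Probability.LatticeModels.ProdBernoulliIndependence
import Literature.Probability.LatticeModels.ProdBernoulliClusterLocality
import Literature.Probability.Percolation.KozmaNitzanPinning
import Summits.CriticalPhenomena.PercolationContinuityZ3.Theorems.PercNearOneGluingNoHeavyLowerTailFatMinoritySignedLemma3
import HarnessLib

/-!
# `NoHeavyLowerTail` (stmt-CriticalPhenomena-4575), line fat-minority-linear — CERTIFICATE TOOLS
# (how a comparison `a ≤ c` is transported along the pinnings of `orderedAnchor_glued`)

Route task `nh-dp-fatminority` (gen 5).  `μ_w = prodBernoulli w`; "`a ≤ c` in `w`" means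
`μ_w(a ↔ b) ≤ μ_w(c ↔ b)`.
* `le_on_of_le_off`, `le_of_le_off` — GLUING LEMMA: for an increasing event `Q` determined by the open
  edge cluster of `c`, if `a ≤ c` OFF `Q` and `μ(a ↮ c, Qᶜ) > 0` then `a ≤ c` ON `Q` and overall
  (signed Lemma 3(i): `μ(D ∖ Q) Δ_Q ≤ μ(D ∩ Q) Δ_{Qᶜ} ≤ 0`).  Gluing vertices onto `c`, or adding pairs at
  `c`, preserves `a ≤ c`; deleting pairs does not.
* `real_openConn_eq_of_blob` — PENDANT BLOB: if a vertex set `W` (not containing `u, v`) has weight-`0`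
  pairs to everything outside `W ∪ {c}`, and `w, w'` agree on all pairs not inside `W ∪ {c}`, then
  `μ_w(u ↔ v) = μ_{w'}(u ↔ v)`.
* `le_of_le_closed` — GLUING STEP: if `a ≤ c` holds with a pair `e` pinned CLOSED and `e` together with
  some weight-`1` pairs `S` lies in the open edge cluster of `c` whenever they are all open, then `a ≤ c`
  holds with `e` at its own weight and with `e` pinned open (gluing lemma at weight `1/2` for `e`; the
  degenerate case `μ(a ↮ c) = 0` separately).  Kozma–Nitzan's Lemma 5 is the case "`0` glued onto `v`".
No new definitions.
-/


namespace Summit.CriticalPhenomena.PercolationContinuityZ3.Theorems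

open MeasureTheory Set
open Literature.Probability.LatticeModels (prodBernoulli)
open Literature.Probability.Percolation (BondConfig openConn openGraph openGraph_adj openEdgeCluster)
open scoped BigOperators

noncomputable section
open Classical
open Literature.Probability.LatticeModels Literature.Probability.Percolation

variable {n : ℕ}

/-- **Gluing lemma, abstract form.**  `Q` increasing and determined by the open edge cluster of `c`;
if `μ({a↔b} ∩ Qᶜ) ≤ μ({c↔b} ∩ Qᶜ)` and `μ({a↮c} ∩ Qᶜ) > 0` then `μ({a↔b} ∩ Q) ≤ μ({c↔b} ∩ Q)`.
[cite: KozmaNitzan2024, Lemma 3(i) p. 6 and Lemma 5 p. 13; VandenbergHaggstromKahn2005, Thm. 1.3–1.4] -/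
theorem le_on_of_le_off (w : Sym2 (Fin n) → unitInterval) (a c b : Fin n) (Q : Set (BondConfig (Fin n)))
    (hQ : ∀ ω ω', ω ∈ Q → openEdgeCluster ω c ⊆ openEdgeCluster ω' c → ω' ∈ Q)
    (hoff : (prodBernoulli w).real (openConn a b ∩ Qᶜ) ≤ (prodBernoulli w).real (openConn c b ∩ Qᶜ))
    (hD : 0 < (prodBernoulli w).real ((openConn a c)ᶜ ∩ Qᶜ)) :
    (prodBernoulli w).real (openConn a b ∩ Q) ≤ (prodBernoulli w).real (openConn c b ∩ Q) := by
  set μ := prodBernoulli w with hμ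
  have hmeas : ∀ E : Set (BondConfig (Fin n)), MeasurableSet E := fun _ => MeasurableSet.of_discrete
  have h := signedLemma3i w a c b Q hQ
  have hab := measureReal_inter_add_sdiff (μ := μ) (s := openConn a b) (t := Q) (hmeas _) (measure_ne_top _ _)
  have hcb := measureReal_inter_add_sdiff (μ := μ) (s := openConn c b) (t := Q) (hmeas _) (measure_ne_top _ _)
  have hDs := measureReal_inter_add_sdiff (μ := μ) (s := (openConn a c)ᶜ) (t := Q) (hmeas _) (measure_ne_top _ _)
  rw [Set.sdiff_eq] at hab hcb hDs
  have hq : 0 ≤ μ.real ((openConn a c)ᶜ ∩ Q) := measureReal_nonneg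
  -- `μ(D ∖ Q) Δ_Q ≤ μ(D ∩ Q) Δ_{Qᶜ} ≤ 0`
  nlinarith [h, hab, hcb, hDs, hq, hD, hoff,
    mul_nonpos_of_nonneg_of_nonpos hq (sub_nonpos.2 hoff)]

/-- **Gluing lemma, total form.**  Under the hypotheses of `le_on_of_le_off`, `μ(a↔b) ≤ μ(c↔b)`.
[cite: KozmaNitzan2024, Lemma 3(i) p. 6] -/
theorem le_of_le_off (w : Sym2 (Fin n) → unitInterval) (a c b : Fin n) (Q : Set (BondConfig (Fin n)))
    (hQ : ∀ ω ω', ω ∈ Q → openEdgeCluster ω c ⊆ openEdgeCluster ω' c → ω' ∈ Q)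
    (hoff : (prodBernoulli w).real (openConn a b ∩ Qᶜ) ≤ (prodBernoulli w).real (openConn c b ∩ Qᶜ))
    (hD : 0 < (prodBernoulli w).real ((openConn a c)ᶜ ∩ Qᶜ)) :
    (prodBernoulli w).real (openConn a b) ≤ (prodBernoulli w).real (openConn c b) := by
  set μ := prodBernoulli w with hμ
  have hmeas : ∀ E : Set (BondConfig (Fin n)), MeasurableSet E := fun _ => MeasurableSet.of_discrete
  have hon := le_on_of_le_off w a c b Q hQ hoff hD
  have hab := measureReal_inter_add_sdiff (μ := μ) (s := openConn a b) (t := Q) (hmeas _) (measure_ne_top _ _)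
  have hcb := measureReal_inter_add_sdiff (μ := μ) (s := openConn c b) (t := Q) (hmeas _) (measure_ne_top _ _)
  rw [Set.sdiff_eq] at hab hcb
  linarith

/-- Walks leave a pendant blob only through its gateway: if every open pair from `W` to the outside of
`W ∪ {c}` is absent from `ω`, then `u ↔ v` (`u, v ∉ W`) in `ω` implies `u ↔ v` in `ω` minus the pairs
inside `W ∪ {c}`. [folklore] -/
theorem reachable_sdiff_blob (W : Finset (Fin n)) (c : Fin n) (ω : BondConfig (Fin n))
    (hω : ∀ z ∈ W, ∀ y : Fin n, y ∉ W → y ≠ c → s(z, y) ∉ ω)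
    {u v : Fin n} (hu : u ∉ W) (hv : v ∉ W) (h : (openGraph ω).Reachable u v) :
    (openGraph (ω \ {e : Sym2 (Fin n) | ∀ y ∈ e, y ∈ W ∨ y = c})).Reachable u v := by
  set P : Set (Sym2 (Fin n)) := {e | ∀ y ∈ e, y ∈ W ∨ y = c} with hP
  obtain ⟨p⟩ := h
  -- claim along the walk: from a vertex outside `W` we reach `v`; from inside `W`, `c` reaches `v`
  have key : ∀ (p₀ v₀ : Fin n) (q : (openGraph ω).Walk p₀ v₀), v₀ ∉ W →
      (p₀ ∉ W → (openGraph (ω \ P)).Reachable p₀ v₀) ∧ (p₀ ∈ W → (openGraph (ω \ P)).Reachable c v₀) := by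
    intro p₀ v₀ q
    induction q with
    | nil =>
        intro hv0
        exact ⟨fun _ => SimpleGraph.Reachable.refl _, fun h => absurd h hv0⟩
    | cons hadj q' ih =>
        intro hv0
        rename_i p₁ p₂ p₃
        have ih' := ih hv0
        rw [openGraph_adj] at hadj
        obtain ⟨he, hne⟩ := hadj
        constructor
        · intro hp₁
          by_cases hp₂ : p₂ ∈ W
          · -- entering the blob: only through `c`
            have hp₁c : p₁ = c := by
              by_contra h
              exact hω p₂ hp₂ p₁ hp₁ h (by rw [Sym2.eq_swap]; exact he)
            rw [hp₁c]; exact ih'.2 hp₂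
          · have hePn : s(p₁, p₂) ∉ P := by
              intro hmem
              have h1 := hmem p₁ (Sym2.mem_mk_left _ _)
              have h2 := hmem p₂ (Sym2.mem_mk_right _ _)
              rcases h1 with h1 | h1
              · exact hp₁ h1
              rcases h2 with h2 | h2
              · exact hp₂ h2
              exact hne (h1.trans h2.symm)
            have hadj' : (openGraph (ω \ P)).Adj p₁ p₂ := (openGraph_adj _ p₁ p₂).2 ⟨⟨he, hePn⟩, hne⟩
            exact hadj'.reachable.trans (ih'.1 hp₂)
        · intro hp₁
          by_cases hp₂ : p₂ ∈ W
          · exact ih'.2 hp₂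
          · -- leaving the blob: only to `c`
            have hp₂c : p₂ = c := by
              by_contra h
              exact hω p₁ hp₁ p₂ hp₂ h he
            rw [← hp₂c]; exact ih'.1 hp₂
  exact (key u v p hv).1 hu

/-- **Pendant-blob invariance.**  `W` a vertex set with `u, v ∉ W`; under `w` and under `w'` every
pair from `W` to a vertex outside `W ∪ {c}` has weight `0`, and `w, w'` agree on every pair not inside
`W ∪ {c}`.  Then `μ_w(u ↔ v) = μ_{w'}(u ↔ v)`. [folklore] -/
theorem real_openConn_eq_of_blob (w w' : Sym2 (Fin n) → unitInterval) (W : Finset (Fin n)) (c u v : Fin n)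
    (hu : u ∉ W) (hv : v ∉ W)
    (hagree : ∀ e : Sym2 (Fin n), ¬ (∀ y ∈ e, y ∈ W ∨ y = c) → w e = w' e)
    (hiso : ∀ z ∈ W, ∀ y : Fin n, y ∉ W → y ≠ c → w s(z, y) = 0) :
    (prodBernoulli w).real (openConn u v) = (prodBernoulli w').real (openConn u v) := by
  set P : Set (Sym2 (Fin n)) := {e | ∀ y ∈ e, y ∈ W ∨ y = c} with hP
  set E' : Set (BondConfig (Fin n)) := {ω | ω \ P ∈ (openConn u v : Set (BondConfig (Fin n)))} with hE'
  have hmeas : ∀ E : Set (BondConfig (Fin n)), MeasurableSet E := fun _ => MeasurableSet.of_discrete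
  have hiso' : ∀ z ∈ W, ∀ y : Fin n, y ∉ W → y ≠ c → w' s(z, y) = 0 := by
    intro z hz y hy hyc
    rw [← hagree s(z, y) (fun h => by
      rcases h y (Sym2.mem_mk_right _ _) with h' | h'
      · exact hy h'
      · exact hyc h')]
    exact hiso z hz y hy hyc
  -- `E'` is determined by the pairs outside `P`, where the weights agree
  have hdet : DeterminedBy E' Pᶜ := by
    refine (determinedBy_iff _ _).2 fun ω ω' hωω' => ?_
    have : ω \ P = ω' \ P := by
      rw [Set.sdiff_eq, Set.sdiff_eq]; exact hωω'
    simp only [hE', Set.mem_setOf_eq, this]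
  have hE'eq : (prodBernoulli w).real E' = (prodBernoulli w').real E' :=
    prodBernoulli_real_eq_of_determinedBy w w' (fun e he => hagree e ((Set.mem_compl_iff _ _).1 he)) hdet (hmeas _)
  -- under either weighting, `{u ↔ v} = E'` up to the null set "some isolated pair open"
  have key : ∀ w₀ : Sym2 (Fin n) → unitInterval,
      (∀ z ∈ W, ∀ y : Fin n, y ∉ W → y ≠ c → w₀ s(z, y) = 0) →
      (prodBernoulli w₀).real (openConn u v) = (prodBernoulli w₀).real E' := by
    intro w₀ h0
    set N : Set (BondConfig (Fin n)) :=
      ⋃ z ∈ W, ⋃ y ∈ (Finset.univ.filter fun y : Fin n => y ∉ W ∧ y ≠ c), {ω | s(z, y) ∈ ω} with hN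
    have hN0 : (prodBernoulli w₀).real N = 0 := by
      refine le_antisymm ((measureReal_biUnion_finset_le W _).trans (le_of_eq ?_)) measureReal_nonneg
      refine Finset.sum_eq_zero fun z hz => ?_
      refine le_antisymm ((measureReal_biUnion_finset_le _ _).trans (le_of_eq ?_)) measureReal_nonneg
      refine Finset.sum_eq_zero fun y hy => ?_
      obtain ⟨hyW, hyc⟩ := (Finset.mem_filter.1 hy).2
      rw [prodBernoulli_real_setOf_mem, h0 z hz y hyW hyc]; rfl
    have hsub1 : (openConn u v : Set (BondConfig (Fin n))) ⊆ E' ∪ N := by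
      intro ω hω
      by_cases hωN : ω ∈ N
      · exact Or.inr hωN
      left
      have hω' : ∀ z ∈ W, ∀ y : Fin n, y ∉ W → y ≠ c → s(z, y) ∉ ω := by
        intro z hz y hy hyc hzy
        exact hωN (Set.mem_iUnion₂.2 ⟨z, hz, Set.mem_iUnion₂.2
          ⟨y, Finset.mem_filter.2 ⟨Finset.mem_univ _, hy, hyc⟩, hzy⟩⟩)
      exact reachable_sdiff_blob W c ω hω' hu hv hω
    have hsub2 : E' ⊆ (openConn u v : Set (BondConfig (Fin n))) := fun ω hω =>
      isUpperSet_openConn u v (fun f hf => hf.1) hω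
    apply le_antisymm
    · calc (prodBernoulli w₀).real (openConn u v) ≤ (prodBernoulli w₀).real (E' ∪ N) :=
            measureReal_mono hsub1 (measure_ne_top _ _)
        _ ≤ (prodBernoulli w₀).real E' + (prodBernoulli w₀).real N := measureReal_union_le _ _
        _ = (prodBernoulli w₀).real E' := by rw [hN0, add_zero]
    · exact measureReal_mono hsub2 (measure_ne_top _ _)
  rw [key w hiso, key w' hiso', hE'eq]

/-- **Gluing step (robust form).**  `e` a pair, `S` a finite set of weight-`1` pairs not containing
`e` such that whenever `e` and all of `S` are open they lie in the open edge cluster of `c`.  If `a ≤ c`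
holds with `e` pinned CLOSED, then `a ≤ c` holds for `w` itself AND with `e` pinned OPEN (gluing along
`e`).  Proof: signed Lemma 3(i) (`le_on_of_le_off`) for the auxiliary weighting with `e` at weight `1/2`;
if `a ↔ c` is almost sure without `e` the comparisons are equalities. [cite: KozmaNitzan2024, Lemma 5 p. 13] -/
theorem le_of_le_closed (w : Sym2 (Fin n) → unitInterval) (a c b : Fin n) (e : Sym2 (Fin n))
    (S : Finset (Sym2 (Fin n))) (hS : ∀ f ∈ S, w f = 1) (heS : e ∉ S)
    (hclus : ∀ ω : BondConfig (Fin n), e ∈ ω → (↑S : Set (Sym2 (Fin n))) ⊆ ω →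
      insert e (↑S : Set (Sym2 (Fin n))) ⊆ openEdgeCluster ω c)
    (hle : (prodBernoulli (pinW w {e} ∅)).real (openConn a b) ≤
      (prodBernoulli (pinW w {e} ∅)).real (openConn c b)) :
    (prodBernoulli w).real (openConn a b) ≤ (prodBernoulli w).real (openConn c b) ∧
      (prodBernoulli (pinW w {e} {e})).real (openConn a b) ≤
        (prodBernoulli (pinW w {e} {e})).real (openConn c b) := by
  have hmeas : ∀ E : Set (BondConfig (Fin n)), MeasurableSet E := fun _ => MeasurableSet.of_discrete
  set ν := prodBernoulli (pinW w {e} ∅) with hν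
  set ρ := prodBernoulli (pinW w {e} {e}) with hρ
  -- auxiliary weighting: `e` at weight 1/2
  set half : unitInterval := ⟨(1 : ℝ) / 2, by norm_num, by norm_num⟩ with hhalf
  set w' : Sym2 (Fin n) → unitInterval := Function.update w e half with hw'
  have hw'e : w' e = half := by rw [hw', Function.update_self]
  have hw'S : ∀ f ∈ S, w' f = 1 := by
    intro f hf
    have hfe : f ≠ e := fun h => heS (h ▸ hf)
    rw [hw', Function.update_of_ne hfe]; exact hS f hf
  have hpin_eq : ∀ ξ : Set (Sym2 (Fin n)), pinW w' {e} ξ = pinW w {e} ξ := by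
    intro ξ; funext i
    by_cases hi : i ∈ ({e} : Set (Sym2 (Fin n)))
    · rw [pinW_apply, pinW_apply]; simp only [hi, if_true]
    · have hie : i ≠ e := fun h => hi (by rw [h]; exact Set.mem_singleton e)
      rw [pinW_apply_of_not_mem w' ξ hi, pinW_apply_of_not_mem w ξ hi, hw', Function.update_of_ne hie]
  set μ' := prodBernoulli w' with hμ'
  set Q : Set (BondConfig (Fin n)) := {ω | e ∈ ω ∧ (↑S : Set (Sym2 (Fin n))) ⊆ ω} with hQdef
  have hQ : ∀ ω ω', ω ∈ Q → openEdgeCluster ω c ⊆ openEdgeCluster ω' c → ω' ∈ Q := by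
    intro ω ω' hω hsub
    have h := hclus ω hω.1 hω.2
    exact ⟨openEdgeCluster_subset ω' c (hsub (h (Set.mem_insert _ _))),
      fun f hf => openEdgeCluster_subset ω' c (hsub (h (Set.mem_insert_of_mem _ hf)))⟩
  -- the pairs of `S` are open a.s. under `μ'`
  set N : Set (BondConfig (Fin n)) := {ω | ¬ (↑S : Set (Sym2 (Fin n))) ⊆ ω} with hNdef
  have hN0 : μ'.real N = 0 := by
    have hsub : N ⊆ ⋃ f ∈ S, {ω | f ∉ ω} := by
      intro ω hω
      simp only [hNdef, Set.mem_setOf_eq, Set.not_subset] at hω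
      obtain ⟨f, hf, hfω⟩ := hω
      exact Set.mem_iUnion₂.2 ⟨f, Finset.mem_coe.1 hf, hfω⟩
    refine le_antisymm ((measureReal_mono hsub (measure_ne_top _ _)).trans
      ((measureReal_biUnion_finset_le S _).trans (le_of_eq ?_))) measureReal_nonneg
    refine Finset.sum_eq_zero fun f hf => ?_
    rw [hμ', prodBernoulli_real_setOf_notMem, hw'S f hf]; simp
  have hnullE : ∀ E E' : Set (BondConfig (Fin n)), E ⊆ E' ∪ N → μ'.real E ≤ μ'.real E' := by
    intro E E' h
    calc μ'.real E ≤ μ'.real (E' ∪ N) := measureReal_mono h (measure_ne_top _ _)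
      _ ≤ μ'.real E' + μ'.real N := measureReal_union_le _ _
      _ = μ'.real E' := by rw [hN0, add_zero]
  have hoffE : ∀ E : Set (BondConfig (Fin n)), μ'.real (E ∩ Qᶜ) = μ'.real (E ∩ {ω | e ∉ ω}) := by
    intro E
    apply le_antisymm
    · refine hnullE _ _ fun ω hω => ?_
      by_cases heω : e ∈ ω
      · exact Or.inr fun hSω => hω.2 ⟨heω, hSω⟩
      · exact Or.inl ⟨hω.1, heω⟩
    · exact measureReal_mono (fun ω hω => ⟨hω.1, fun hq => hω.2 hq.1⟩) (measure_ne_top _ _)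
  have honE : ∀ E : Set (BondConfig (Fin n)), μ'.real (E ∩ Q) = μ'.real (E ∩ {ω | e ∈ ω}) := by
    intro E
    apply le_antisymm
    · exact measureReal_mono (fun ω hω => ⟨hω.1, hω.2.1⟩) (measure_ne_top _ _)
    · refine hnullE _ _ fun ω hω => ?_
      by_cases hSω : (↑S : Set (Sym2 (Fin n))) ⊆ ω
      · exact Or.inl ⟨hω.1, hω.2, hSω⟩
      · exact Or.inr hSω
  have hcylC : ({ω : BondConfig (Fin n) | e ∉ ω} : Set (BondConfig (Fin n))) =
      localCylinder (↑({e} : Finset (Sym2 (Fin n))) : Set (Sym2 (Fin n))) ∅ := by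
    ext ω
    simp only [Set.mem_setOf_eq, localCylinder, Finset.coe_singleton, Set.mem_singleton_iff, forall_eq,
      Set.mem_empty_iff_false, iff_false]
  have hcylO : ({ω : BondConfig (Fin n) | e ∈ ω} : Set (BondConfig (Fin n))) =
      localCylinder (↑({e} : Finset (Sym2 (Fin n))) : Set (Sym2 (Fin n))) {e} := by
    ext ω
    simp only [Set.mem_setOf_eq, localCylinder, Finset.coe_singleton, Set.mem_singleton_iff, forall_eq,
      iff_true]
  have hpinC : ∀ E : Set (BondConfig (Fin n)), μ'.real (E ∩ {ω | e ∉ ω}) =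
      μ'.real {ω : BondConfig (Fin n) | e ∉ ω} * ν.real E := by
    intro E
    rw [hcylC, hμ', prodBernoulli_real_inter_localCylinder w' {e} ∅ (hmeas E), Finset.coe_singleton,
      hpin_eq ∅]
  have hpinO : ∀ E : Set (BondConfig (Fin n)), μ'.real (E ∩ {ω | e ∈ ω}) =
      μ'.real {ω : BondConfig (Fin n) | e ∈ ω} * ρ.real E := by
    intro E
    rw [hcylO, hμ', prodBernoulli_real_inter_localCylinder w' {e} {e} (hmeas E), Finset.coe_singleton,
      hpin_eq {e}]
  have hc0 : 0 < μ'.real {ω : BondConfig (Fin n) | e ∉ ω} := by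
    rw [hμ', prodBernoulli_real_setOf_notMem, hw'e, hhalf]; norm_num
  have hO0 : 0 < μ'.real {ω : BondConfig (Fin n) | e ∈ ω} := by
    rw [hμ', prodBernoulli_real_setOf_mem, hw'e, hhalf]; norm_num
  -- (B): the glued comparison
  have hB : ρ.real (openConn a b) ≤ ρ.real (openConn c b) := by
    by_cases hD : 0 < ν.real (openConn a c)ᶜ
    · have hon := le_on_of_le_off w' a c b Q hQ
        (by rw [hoffE, hoffE, hpinC, hpinC]; exact mul_le_mul_of_nonneg_left hle measureReal_nonneg)
        (by rw [hoffE, hpinC]; exact mul_pos hc0 hD)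
      rw [honE, honE, hpinO, hpinO] at hon
      exact le_of_mul_le_mul_left hon hO0
    · -- degenerate: `a ↔ c` a.s. without `e`, hence with `e` open; then `{a↔b} ⊆ {c↔b}` a.s.
      have hD0 : ν.real (openConn a c)ᶜ = 0 := le_antisymm (not_lt.1 hD) measureReal_nonneg
      have hνac : ν.real (openConn a c) = 1 := by
        have h := measureReal_add_measureReal_compl (μ := ν) (s := openConn a c) (hmeas _)
        rwa [hD0, add_zero, probReal_univ] at h
      have hρac : ρ.real (openConn a c) = 1 := by
        apply le_antisymm measureReal_le_one
        rw [← hνac, hν, hρ]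
        refine prodBernoulli_real_mono_of_isUpperSet (fun f => ?_) (isUpperSet_openConn a c) (hmeas _)
        by_cases hf : f ∈ ({e} : Set (Sym2 (Fin n)))
        · rw [pinW_apply_of_mem_of_not_mem w hf (Set.notMem_empty f)]; exact bot_le
        · rw [pinW_apply_of_not_mem w _ hf, pinW_apply_of_not_mem w _ hf]
      have hρD : ρ.real (openConn a c)ᶜ = 0 := by
        have h := measureReal_add_measureReal_compl (μ := ρ) (s := openConn a c) (hmeas _)
        rw [hρac, probReal_univ] at h
        linarith
      have h1 : ρ.real (openConn a b) ≤ ρ.real (openConn a b ∩ openConn a c) + ρ.real (openConn a c)ᶜ := by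
        calc ρ.real (openConn a b) ≤ ρ.real ((openConn a b ∩ openConn a c) ∪ (openConn a c)ᶜ) :=
              measureReal_mono (fun ω hω => by
                by_cases h : ω ∈ (openConn a c : Set (BondConfig (Fin n)))
                · exact Or.inl ⟨hω, h⟩
                · exact Or.inr h) (measure_ne_top _ _)
          _ ≤ _ := measureReal_union_le _ _
      have h2 : ρ.real (openConn a b ∩ openConn a c) ≤ ρ.real (openConn c b) :=
        measureReal_mono (fun ω ⟨hab, hac⟩ =>
          ((hac : (openGraph ω).Reachable a c).symm.trans (hab : (openGraph ω).Reachable a b)))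
          (measure_ne_top _ _)
      linarith
  refine ⟨?_, hB⟩
  -- (A): `μ_w` is a mixture of the closed and the open world
  have hsplit : ∀ E : Set (BondConfig (Fin n)), (prodBernoulli w).real E =
      (prodBernoulli w).real {ω : BondConfig (Fin n) | e ∉ ω} * ν.real E +
        (prodBernoulli w).real {ω : BondConfig (Fin n) | e ∈ ω} * ρ.real E := by
    intro E
    have h := measureReal_inter_add_sdiff (μ := prodBernoulli w) (s := E)
      (t := {ω : BondConfig (Fin n) | e ∉ ω}) (hmeas _) (measure_ne_top _ _)
    rw [Set.sdiff_eq, show ({ω : BondConfig (Fin n) | e ∉ ω}ᶜ : Set (BondConfig (Fin n))) =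
      {ω | e ∈ ω} by ext ω; simp] at h
    rw [← h, hcylC, hcylO, prodBernoulli_real_inter_localCylinder w {e} ∅ (hmeas E),
      prodBernoulli_real_inter_localCylinder w {e} {e} (hmeas E), Finset.coe_singleton]
  rw [hsplit (openConn a b), hsplit (openConn c b)]
  exact add_le_add (mul_le_mul_of_nonneg_left hle measureReal_nonneg)
    (mul_le_mul_of_nonneg_left hB measureReal_nonneg)

end

end Summit.CriticalPhenomena.PercolationContinuityZ3.Theorems
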